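import Summits.Ventures.PercRepro.S1CapTenSix

/-!
# PercRepro — TWO PLANES THROUGH A LINE AND A POINT (p2, gen 25; SUBCLAIM-S1 §6.9 (xii) T4, part 1)

For a point `x` on three distinct triangles `Lᵢ, Lⱼ, Lₖ` and a point `s ∉ Lᵢ`: two rank-`3` sets
`{x, a, b, s}` and `{x, a', c, s}` with `a, a' ∈ Lᵢ ∖ x`, `b ∈ Lⱼ ∖ x`, `c ∈ Lₖ ∖ x` cannot both exist — each spans the
plane `cl (Lᵢ ∪ s)`, which would then hold `Lᵢ ∪ Lⱼ ∪ Lₖ`, `7` points (C2). This is the matching constraint of the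
degree-`4` count (S1ConeFour).

* **`not_two_planes_through_line`**.
Axioms: standard.
-/

open scoped Matroid

namespace PercRepro

namespace S1

open Set

variable {α : Type}

/-- **Two rank-`3` sets through `x`, a point of `Lᵢ` and the same outside point `s` cannot reach two further
lines**: with `a, a' ∈ Lᵢ ∖ x`, `b ∈ Lⱼ ∖ x`, `c ∈ Lₖ ∖ x` (`Lᵢ, Lⱼ, Lₖ` distinct triangles through `x`), `s ∉ Lᵢ`,
`r {x, a, b, s} = r {x, a', c, s} = 3` is impossible — both sets span the plane `cl (Lᵢ ∪ s)`, which would hold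
`Lᵢ ∪ Lⱼ ∪ Lₖ`. -/
theorem not_two_planes_through_line (N : Matroid α) [N.Finite]
    (hC1 : ∀ L ⊆ N.E, N.eRk L = 2 → L.ncard ≤ 3) (hC2 : ∀ P ⊆ N.E, N.eRk P ≤ 3 → P.ncard ≤ 6)
    {x : α} {Li Lj Lk : Set α} (hLi : Li ∈ ThmN.trianglesThrough N x) (hLj : Lj ∈ ThmN.trianglesThrough N x)
    (hLk : Lk ∈ ThmN.trianglesThrough N x) (hij : Li ≠ Lj) (hik : Li ≠ Lk) (hjk : Lj ≠ Lk)
    {a a' b c s : α} (ha : a ∈ Li) (hax : a ≠ x) (ha' : a' ∈ Li) (ha'x : a' ≠ x) (hb : b ∈ Lj) (hbx : b ≠ x)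
    (hc : c ∈ Lk) (hcx : c ≠ x) (hs : s ∈ N.E) (hsLi : s ∉ Li)
    (hr : N.eRk {x, a, b, s} = 3) (hr' : N.eRk {x, a', c, s} = 3) : False := by
  have hLiE := hLi.1.subset_ground
  have hLjE := hLj.1.subset_ground
  have hLkE := hLk.1.subset_ground
  have hxE : x ∈ N.E := hLiE hLi.2.2
  -- the plane `Q = cl (Li ∪ {s})`
  set Q := N.closure (insert s Li) with hQ
  have hQrank : N.eRk (insert s Li) ≤ 3 := by
    calc N.eRk (insert s Li) ≤ N.eRk Li + 1 := N.eRk_insert_le_add_one s Li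
      _ ≤ 3 := by
        have h := hLi.1.eRk_add_one_eq
        rw [← (N.ground_finite.subset hLiE).cast_ncard_eq, hLi.2.1] at h
        have hfin : N.eRk Li ≠ ⊤ := ((N.eRk_le_encard Li).trans_lt (N.ground_finite.subset hLiE).encard_lt_top).ne
        obtain ⟨r, hr⟩ := ENat.ne_top_iff_exists.1 hfin
        rw [← hr] at h ⊢
        have : r + 1 = 3 := by exact_mod_cast h
        norm_cast; omega
  have h6 := ncard_closure_le_six_of_eRk_three N hC2 hQrank
  -- a line through `x` and a point `a₀ ∈ Li ∖ x` with `r {x, a₀, b₀, s} = 3` lies in `Q`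
  have hline : ∀ {a₀ b₀ : α} {L₀ : Set α}, L₀ ∈ ThmN.trianglesThrough N x → a₀ ∈ Li → a₀ ≠ x → b₀ ∈ L₀ → b₀ ≠ x →
      N.eRk {x, a₀, b₀, s} = 3 → L₀ ⊆ Q := by
    intro a₀ b₀ L₀ hL₀ ha₀ ha₀x hb₀ hb₀x hr₀
    -- `{x, a₀, s}` has rank `3`: `s ∉ cl {x, a₀} = Li`
    have hxa : ({x, a₀} : Set α) ⊆ Li := by rintro z (rfl | rfl); exact hLi.2.2; exact ha₀
    have hind : N.Indep {x, a₀} := hLi.1.ssubset_indep (Set.ssubset_iff_subset_ne.2 ⟨hxa, fun h => by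
      have := congrArg Set.ncard h; rw [Set.ncard_pair (Ne.symm ha₀x), hLi.2.1] at this; omega⟩)
    have hr2 : N.eRk {x, a₀} = 2 := by rw [hind.eRk_eq_encard, Set.encard_pair (Ne.symm ha₀x)]
    have hcl : N.closure {x, a₀} = Li := by
      apply le_antisymm
      · calc N.closure {x, a₀} ⊆ N.closure Li := N.closure_subset_closure hxa
          _ = Li := closure_eq_of_triangle N hC1 hLi.1 hLi.2.1
      · exact triangle_subset_closure_pair' N hLi.1 hLi.2.1 hLi.2.2 ha₀ (Ne.symm ha₀x)
    have hscl : s ∉ N.closure {x, a₀} := by rw [hcl]; exact hsLi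
    have hr3 : N.eRk (insert s {x, a₀}) = 3 := by
      rw [N.eRk_insert_eq_add_one ⟨hs, hscl⟩, hr2]; rfl
    have hxas : insert s ({x, a₀} : Set α) ⊆ N.E := by
      rintro z (rfl | rfl | rfl) <;> first | exact hs | exact hxE | exact hLiE ha₀
    -- `b₀ ∈ cl {x, a₀, s}`
    have heq : ({x, a₀, b₀, s} : Set α) = insert b₀ (insert s {x, a₀}) := by ext; simp; tauto
    have hb₀cl : b₀ ∈ N.closure (insert s {x, a₀}) :=
      mem_closure_of_eRk_insert_le N hxas (hL₀.1.subset_ground hb₀) (by rw [← heq, hr₀, hr3])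
    have hsub : N.closure (insert s {x, a₀}) ⊆ Q :=
      N.closure_subset_closure (Set.insert_subset_insert hxa)
    refine (triangle_subset_closure_pair' N hL₀.1 hL₀.2.1 hL₀.2.2 hb₀ (Ne.symm hb₀x)).trans ?_
    have : ({x, b₀} : Set α) ⊆ Q := by
      rintro z (rfl | rfl)
      · exact N.subset_closure _ (Set.insert_subset hs hLiE) (Or.inr hLi.2.2)
      · exact hsub hb₀cl
    calc N.closure {x, b₀} ⊆ N.closure Q := N.closure_subset_closure this
      _ = Q := N.closure_closure _
  have hLjQ : Lj ⊆ Q := hline hLj ha hax hb hbx hr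
  have hLkQ : Lk ⊆ Q := hline hLk ha' ha'x hc hcx hr'
  have hLiQ : Li ⊆ Q := (Set.subset_insert s Li).trans (N.subset_closure _ (Set.insert_subset hs hLiE))
  -- `Li ∪ Lj ∪ Lk` has `7` points inside `Q`
  have h5 := ncard_union_eq_five_of_trianglesThrough N hC1 hLi hLj hij
  have hint : (Li ∪ Lj) ∩ Lk = {x} := by
    rw [Set.union_inter_distrib_right, ThmN.inter_eq_singleton_of_mem_trianglesThrough N hC1 hLi hLk hik,
      ThmN.inter_eq_singleton_of_mem_trianglesThrough N hC1 hLj hLk hjk, Set.union_self]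
  have h7 : (Li ∪ Lj ∪ Lk).ncard = 7 := by
    have h := Set.ncard_union_add_ncard_inter (Li ∪ Lj) Lk
      (N.ground_finite.subset (Set.union_subset hLiE hLjE)) (N.ground_finite.subset hLkE)
    rw [hint, Set.ncard_singleton, h5, hLk.2.1] at h
    omega
  have := Set.ncard_le_ncard (Set.union_subset (Set.union_subset hLiQ hLjQ) hLkQ)
    (N.ground_finite.subset (N.closure_subset_ground _))
  rw [hQ] at this
  omega

end S1

end PercRepro
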